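import Summits.QuantumFields.YangMills.Theorems.AllWindowsColdBoxBoxHighLineTripleBond
import Summits.QuantumFields.YangMills.Theorems.AllWindowsColdBoxBoxHighLineEdgeTwoCentreSums

/-!
# Plaquette-indexed one- and two-centre lattice sums over `plaquettesTouching` the cold box (U5 prep, lift L3)

LEAD seat `ym-line-sfw-p2` (g78), cell ym-idea-1; helper-grade counting glue for the connected four-point estimate (`…ConnectedFourPointPair` summed over the
plaquette pair, this seat's `…ConnectedFourPointCubic`).  The landed lattice sums ✓T-S5.8a `cubeShellSums` / ✓8b `cubeTwoCentreSums` run over the SITES of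
`cubeSites N`; the cubic vertices are indexed by PLAQUETTES `p ∈ plaquettesTouching (boxEdges 4 (2H+1))` through their base points `p.1 ∈ [−1, 2H]⁴`
(✓`base_bounds_of_mem_plaquettesTouching`).  This file bridges the two (companion of w3 g41's ✓`…EdgeTwoCentreSums` for edges):

* `sum_plaquettesTouching_le` — `Σ_{p touching} g(p.1) ≤ 16·Σ_{z ∈ cubeSites(2H+1)} g(z − 1)` for `g ≥ 0` (shift by `(1,1,1,1)`, `≤ 16` orientations per base point);
* `siteDist_sub_one`, `one_add_log_le` — `d(z − 1, u) = d(z, u + 1)`, `1 + log(2H+1) ≤ 4(1 + log H)`;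
* ★ `plaquetteCentreSums` — `∃ C ≥ 0, ∀ H ≥ 1, ∀ u v`: `Σ_p (1+d(p.1,u))⁻⁴ ≤ C(1+log H)`, `Σ_p (1+d(p.1,u))⁻²(1+d(p.1,v))⁻² ≤ C(1+log H)`,
  `Σ_p (1+d(p.1,u))⁻²(1+d(p.1,v))⁻⁴ ≤ C(1+log H)/(1+d(u,v))²`;
* ★ `plaquettePairSums` — the four double sums of the cubic-pair diagrams: `ΣΣ (1+d(x,y))⁻⁴(1+d(x,x₀))⁻²(1+d(y,x_T))⁻²`, its mirror, `ΣΣ (1+d(x,x₀))⁻⁴(1+d(y,x_T))⁻⁴`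
  and its mirror are all `≤ C·(1+log H)²` (`x = p.1`, `y = p'.1`).

Everything proved, no definitions, standard axioms.  HONEST LABEL: counting glue for the RECORDED lift L3 of the NEXT rung U5 (⟨stmt-QuantumFields-24336⟩, UNSTAFFED);
⟨24004⟩ ⟨24336⟩ and this seat's crux ⟨stmt-QuantumFields-22884⟩ remain OPEN; route AllWindowsColdBox is DRAFT; no crux, rung or summit is proved; **the Yang–Mills mass gap is
NOT proved by this file; no summit is proved by a line.**
-/

set_option autoImplicit false

noncomputable section

open Finset
open Literature.Probability.LatticeModels (Site)
open Literature.MathematicalPhysics.QuantumLattice (ZdPlaquette plaquettesTouching)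
open Literature.MathematicalPhysics.QuantumFieldTheory.AxialGauge (boxEdges)

namespace Summit.QuantumFields.YangMills.Theorems.AllWindowsColdBoxBoxHighLine

namespace PlaqSums

/-! ## From plaquettes touching the box to cube sites -/

/-- ★ **Plaquette sums are at most sixteen cube sums**: `Σ_{p ∈ plaquettesTouching(boxEdges 4 (2H+1))} g(p.1) ≤ 16·Σ_{z ∈ cubeSites(2H+1)} g(z − 1)` for `g ≥ 0`. -/
theorem sum_plaquettesTouching_le (H : ℕ) (g : Site 4 → ℝ) (hg : ∀ z, 0 ≤ g z) :
    ∑ p ∈ plaquettesTouching (boxEdges 4 (2 * H + 1)), g p.1 ≤ 16 * ∑ z ∈ cubeSites (2 * H + 1), g (z - 1) := by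
  classical
  set PT := plaquettesTouching (boxEdges 4 (2 * H + 1)) with hPT
  set φ : ZdPlaquette 4 → Site 4 × {q : Fin 4 × Fin 4 // q.1 < q.2} := fun p => (p.1 + 1, p.2) with hφ
  have hinj : Function.Injective φ := by
    intro p p' h
    simp only [hφ, Prod.mk.injEq, add_left_inj] at h
    exact Prod.ext h.1 h.2
  have himg : ∀ p ∈ PT, φ p ∈ cubeSites (2 * H + 1) ×ˢ (Finset.univ : Finset {q : Fin 4 × Fin 4 // q.1 < q.2}) := by
    intro p hp
    refine Finset.mem_product.2 ⟨?_, Finset.mem_univ _⟩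
    simp only [cubeSites, Fintype.mem_piFinset, Finset.mem_Icc, hφ]
    intro k
    have hb := base_bounds_of_mem_plaquettesTouching hp k
    simp only [Pi.add_apply, Pi.one_apply]
    constructor
    · omega
    · push_cast; omega
  have h1 : ∑ p ∈ PT, g p.1 = ∑ z ∈ PT.image φ, g (z.1 - 1) := by
    rw [Finset.sum_image fun p _ p' _ h => hinj h]
    refine Finset.sum_congr rfl fun p _ => ?_
    simp only [hφ, add_sub_cancel_right]
  rw [h1]
  have hcard : ((Finset.univ : Finset {q : Fin 4 × Fin 4 // q.1 < q.2}).card : ℝ) ≤ 16 := by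
    have h3 : Fintype.card {q : Fin 4 × Fin 4 // q.1 < q.2} ≤ 16 := (Fintype.card_subtype_le _).trans (by simp)
    rw [Finset.card_univ]
    exact_mod_cast h3
  calc ∑ z ∈ PT.image φ, g (z.1 - 1)
      ≤ ∑ z ∈ cubeSites (2 * H + 1) ×ˢ (Finset.univ : Finset {q : Fin 4 × Fin 4 // q.1 < q.2}), g (z.1 - 1) :=
        Finset.sum_le_sum_of_subset_of_nonneg (fun z hz => by
          obtain ⟨p, hp, rfl⟩ := Finset.mem_image.1 hz; exact himg p hp) (fun z _ _ => hg _)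
    _ = ∑ z ∈ cubeSites (2 * H + 1), ((Finset.univ : Finset {q : Fin 4 × Fin 4 // q.1 < q.2}).card : ℝ) * g (z - 1) := by
        rw [Finset.sum_product]
        refine Finset.sum_congr rfl fun z _ => ?_
        dsimp only
        rw [Finset.sum_const, nsmul_eq_mul]
    _ ≤ ∑ z ∈ cubeSites (2 * H + 1), 16 * g (z - 1) :=
        Finset.sum_le_sum fun z _ => mul_le_mul_of_nonneg_right hcard (hg _)
    _ = 16 * ∑ z ∈ cubeSites (2 * H + 1), g (z - 1) := by rw [Finset.mul_sum]

/-- Translation: `d(z − 1, u) = d(z, u + 1)`. -/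
theorem siteDist_sub_one (z u : Site 4) : siteDist (z - 1) u = siteDist z (u + 1) := by
  have h := EdgeSums.siteDist_sub_sub z (u + 1) 1
  rw [add_sub_cancel_right] at h
  exact h

/-- Translation: `d(u + 1, v + 1) = d(u, v)`. -/
theorem siteDist_add_one (u v : Site 4) : siteDist (u + 1) (v + 1) = siteDist u v := by
  have h := EdgeSums.siteDist_sub_sub (u + 1) (v + 1) 1
  rw [add_sub_cancel_right, add_sub_cancel_right] at h
  exact h.symm

/-- `1 + log(2H+1) ≤ 4·(1 + log H)` for `H ≥ 1` (✓`EdgeSums.one_add_log_cube_le` and monotonicity of `log`). -/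
theorem one_add_log_le {H : ℕ} (hH : 1 ≤ H) : 1 + Real.log (((2 * H + 1 : ℕ)) : ℝ) ≤ 4 * (1 + Real.log H) := by
  have h := EdgeSums.one_add_log_cube_le hH
  have hmono : Real.log (((2 * H + 1 : ℕ)) : ℝ) ≤ Real.log (((2 * H + 2 : ℕ)) : ℝ) :=
    Real.log_le_log (by positivity) (by push_cast; linarith)
  linarith

/-! ## One- and two-centre plaquette sums -/

/-- ★ **Plaquette-indexed centre sums** (✓8a/8b moved to `plaquettesTouching` by `sum_plaquettesTouching_le`). -/
theorem plaquetteCentreSums : ∃ C : ℝ, 0 ≤ C ∧ ∀ H : ℕ, 1 ≤ H → ∀ u v : Site 4,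
    (∑ p ∈ plaquettesTouching (boxEdges 4 (2 * H + 1)), 1 / (1 + siteDist p.1 u) ^ 4 ≤ C * (1 + Real.log H)) ∧
    (∑ p ∈ plaquettesTouching (boxEdges 4 (2 * H + 1)), 1 / ((1 + siteDist p.1 u) ^ 2 * (1 + siteDist p.1 v) ^ 2) ≤ C * (1 + Real.log H)) ∧
    (∑ p ∈ plaquettesTouching (boxEdges 4 (2 * H + 1)), 1 / ((1 + siteDist p.1 u) ^ 2 * (1 + siteDist p.1 v) ^ 4) ≤
      C * (1 + Real.log H) / (1 + siteDist u v) ^ 2) := by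
  obtain ⟨C₁, h8a⟩ := cubeShellSums
  obtain ⟨C₂, h8b⟩ := cubeTwoCentreSums
  have hC₁ : 0 ≤ C₁ := by
    have h := (h8a 1 le_rfl 0).2.2
    exact le_trans (Finset.sum_nonneg fun p _ => by have := GhostKernel.siteDist_nonneg p 0; positivity) h
  have hC₂ : 0 ≤ C₂ := by
    have h := (h8b 1 le_rfl 0 0).1
    have hs : 0 ≤ ∑ p ∈ cubeSites 1, 1 / ((1 + siteDist p 0) ^ 2 * (1 + siteDist p 0) ^ 2) :=
      Finset.sum_nonneg fun p _ => by have := GhostKernel.siteDist_nonneg p 0; positivity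
    have h' : (0 : ℝ) ≤ C₂ * (1 + Real.log ((1 : ℕ) : ℝ)) := hs.trans h
    simpa using h'
  refine ⟨64 * max C₁ C₂, by positivity, fun H hH u v => ?_⟩
  have hN : 1 ≤ 2 * H + 1 := by omega
  have hlog := one_add_log_le hH
  have hL0 : 0 ≤ 1 + Real.log (((2 * H + 1 : ℕ)) : ℝ) := by
    have : (1 : ℝ) ≤ ((2 * H + 1 : ℕ) : ℝ) := by exact_mod_cast hN
    linarith [Real.log_nonneg this]
  have hLH : 0 ≤ 1 + Real.log H := by
    have : (1 : ℝ) ≤ H := by exact_mod_cast hH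
    linarith [Real.log_nonneg this]
  have hmax1 : C₁ ≤ max C₁ C₂ := le_max_left _ _
  have hmax2 : C₂ ≤ max C₁ C₂ := le_max_right _ _
  refine ⟨?_, ?_, ?_⟩
  · have h1 := sum_plaquettesTouching_le H (fun z => 1 / (1 + siteDist z u) ^ 4) fun z => by have := GhostKernel.siteDist_nonneg z u; positivity
    simp only [siteDist_sub_one] at h1
    have h2 := (h8a (2 * H + 1) hN (u + 1)).2.1
    calc _ ≤ 16 * ∑ z ∈ cubeSites (2 * H + 1), 1 / (1 + siteDist z (u + 1)) ^ 4 := h1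
      _ ≤ 16 * (C₁ * (1 + Real.log (((2 * H + 1 : ℕ)) : ℝ))) := by
          refine mul_le_mul_of_nonneg_left ?_ (by norm_num); exact_mod_cast h2
      _ ≤ 16 * (max C₁ C₂ * (4 * (1 + Real.log H))) := by gcongr
      _ = 64 * max C₁ C₂ * (1 + Real.log H) := by ring
  · have h1 := sum_plaquettesTouching_le H (fun z => 1 / ((1 + siteDist z u) ^ 2 * (1 + siteDist z v) ^ 2)) fun z => by
      have := GhostKernel.siteDist_nonneg z u; have := GhostKernel.siteDist_nonneg z v; positivity
    simp only [siteDist_sub_one] at h1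
    have h2 := (h8b (2 * H + 1) hN (u + 1) (v + 1)).1
    calc _ ≤ 16 * ∑ z ∈ cubeSites (2 * H + 1), 1 / ((1 + siteDist z (u + 1)) ^ 2 * (1 + siteDist z (v + 1)) ^ 2) := h1
      _ ≤ 16 * (C₂ * (1 + Real.log (((2 * H + 1 : ℕ)) : ℝ))) := by
          refine mul_le_mul_of_nonneg_left ?_ (by norm_num); exact_mod_cast h2
      _ ≤ 16 * (max C₁ C₂ * (4 * (1 + Real.log H))) := by gcongr
      _ = 64 * max C₁ C₂ * (1 + Real.log H) := by ring
  · have h1 := sum_plaquettesTouching_le H (fun z => 1 / ((1 + siteDist z u) ^ 2 * (1 + siteDist z v) ^ 4)) fun z => by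
      have := GhostKernel.siteDist_nonneg z u; have := GhostKernel.siteDist_nonneg z v; positivity
    simp only [siteDist_sub_one] at h1
    have h2 := (h8b (2 * H + 1) hN (u + 1) (v + 1)).2.1
    rw [siteDist_add_one] at h2
    have hd : 0 < (1 + siteDist u v) ^ 2 := by have := GhostKernel.siteDist_nonneg u v; positivity
    calc _ ≤ 16 * ∑ z ∈ cubeSites (2 * H + 1), 1 / ((1 + siteDist z (u + 1)) ^ 2 * (1 + siteDist z (v + 1)) ^ 4) := h1
      _ ≤ 16 * (C₂ * (1 + Real.log (((2 * H + 1 : ℕ)) : ℝ)) / (1 + siteDist u v) ^ 2) := by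
          refine mul_le_mul_of_nonneg_left ?_ (by norm_num); exact_mod_cast h2
      _ ≤ 16 * (max C₁ C₂ * (4 * (1 + Real.log H)) / (1 + siteDist u v) ^ 2) := by gcongr
      _ = 64 * max C₁ C₂ * (1 + Real.log H) / (1 + siteDist u v) ^ 2 := by ring

/-- ★★ **The four double sums of the cubic-pair diagrams** (`x = p.1`, `y = p'.1`, all `≤ C·(1+log H)²`):
(i) `ΣΣ (1+d(x,y))⁻⁴(1+d(x,x₀))⁻²(1+d(y,x_T))⁻²`, (ii) `ΣΣ (1+d(x,y))⁻⁴(1+d(y,x₀))⁻²(1+d(x,x_T))⁻²`, (iii) `ΣΣ (1+d(x,x₀))⁻⁴(1+d(y,x_T))⁻⁴`,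
(iv) `ΣΣ (1+d(y,x₀))⁻⁴(1+d(x,x_T))⁻⁴`. -/
theorem plaquettePairSums : ∃ C : ℝ, 0 ≤ C ∧ ∀ H : ℕ, 1 ≤ H → ∀ x₀ xT : Site 4,
    (∑ p ∈ plaquettesTouching (boxEdges 4 (2 * H + 1)), ∑ p' ∈ plaquettesTouching (boxEdges 4 (2 * H + 1)),
        1 / (1 + siteDist p.1 p'.1) ^ 4 * (1 / (1 + siteDist p.1 x₀) ^ 2) * (1 / (1 + siteDist p'.1 xT) ^ 2) ≤ C * (1 + Real.log H) ^ 2) ∧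
    (∑ p ∈ plaquettesTouching (boxEdges 4 (2 * H + 1)), ∑ p' ∈ plaquettesTouching (boxEdges 4 (2 * H + 1)),
        1 / (1 + siteDist p.1 p'.1) ^ 4 * (1 / (1 + siteDist p'.1 x₀) ^ 2) * (1 / (1 + siteDist p.1 xT) ^ 2) ≤ C * (1 + Real.log H) ^ 2) ∧
    (∑ p ∈ plaquettesTouching (boxEdges 4 (2 * H + 1)), ∑ p' ∈ plaquettesTouching (boxEdges 4 (2 * H + 1)),
        1 / (1 + siteDist p.1 x₀) ^ 4 * (1 / (1 + siteDist p'.1 xT) ^ 4) ≤ C * (1 + Real.log H) ^ 2) ∧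
    (∑ p ∈ plaquettesTouching (boxEdges 4 (2 * H + 1)), ∑ p' ∈ plaquettesTouching (boxEdges 4 (2 * H + 1)),
        1 / (1 + siteDist p'.1 x₀) ^ 4 * (1 / (1 + siteDist p.1 xT) ^ 4) ≤ C * (1 + Real.log H) ^ 2) := by
  obtain ⟨C, hC0, hC⟩ := plaquetteCentreSums
  refine ⟨C ^ 2, by positivity, fun H hH x₀ xT => ?_⟩
  set PT := plaquettesTouching (boxEdges 4 (2 * H + 1)) with hPT
  set L := 1 + Real.log H with hL
  have hLH : 0 ≤ L := by
    have : (1 : ℝ) ≤ H := by exact_mod_cast hH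
    have := Real.log_nonneg this; rw [hL]; linarith
  have g2nn : ∀ a b : Site 4, 0 ≤ 1 / (1 + siteDist a b) ^ 2 := fun a b => by have := GhostKernel.siteDist_nonneg a b; positivity
  have g4nn : ∀ a b : Site 4, 0 ≤ 1 / (1 + siteDist a b) ^ 4 := fun a b => by have := GhostKernel.siteDist_nonneg a b; positivity
  -- inner two-centre sum: `Σ_{p'} (1+d(x,y))⁻⁴ (1+d(y,w))⁻² ≤ C L (1+d(x,w))⁻²`
  have hinner : ∀ x w : Site 4, ∑ p' ∈ PT, 1 / (1 + siteDist x p'.1) ^ 4 * (1 / (1 + siteDist p'.1 w) ^ 2) ≤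
      C * L * (1 / (1 + siteDist x w) ^ 2) := by
    intro x w
    have h := (hC H hH w x).2.2
    have heq : ∀ p' : ZdPlaquette 4, 1 / (1 + siteDist x p'.1) ^ 4 * (1 / (1 + siteDist p'.1 w) ^ 2) =
        1 / ((1 + siteDist p'.1 w) ^ 2 * (1 + siteDist p'.1 x) ^ 4) := by
      intro p'; rw [EdgeChartGaussian.siteDist_comm x p'.1]; field_simp
    simp_rw [heq]
    refine h.trans (le_of_eq ?_)
    rw [EdgeChartGaussian.siteDist_comm w x, hL]; field_simp
  have hone : ∀ w : Site 4, ∑ p ∈ PT, 1 / (1 + siteDist p.1 w) ^ 4 ≤ C * L := fun w => (hC H hH w w).1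
  have htwo : ∀ u w : Site 4, ∑ p ∈ PT, 1 / (1 + siteDist p.1 u) ^ 2 * (1 / (1 + siteDist p.1 w) ^ 2) ≤ C * L := by
    intro u w
    have h := (hC H hH u w).2.1
    refine le_trans (le_of_eq (Finset.sum_congr rfl fun p _ => ?_)) h
    field_simp
  refine ⟨?_, ?_, ?_, ?_⟩
  · calc ∑ p ∈ PT, ∑ p' ∈ PT, 1 / (1 + siteDist p.1 p'.1) ^ 4 * (1 / (1 + siteDist p.1 x₀) ^ 2) * (1 / (1 + siteDist p'.1 xT) ^ 2)
        = ∑ p ∈ PT, 1 / (1 + siteDist p.1 x₀) ^ 2 * ∑ p' ∈ PT, 1 / (1 + siteDist p.1 p'.1) ^ 4 * (1 / (1 + siteDist p'.1 xT) ^ 2) := by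
          refine Finset.sum_congr rfl fun p _ => ?_
          rw [Finset.mul_sum]
          exact Finset.sum_congr rfl fun p' _ => by ring
      _ ≤ ∑ p ∈ PT, 1 / (1 + siteDist p.1 x₀) ^ 2 * (C * L * (1 / (1 + siteDist p.1 xT) ^ 2)) :=
          Finset.sum_le_sum fun p _ => mul_le_mul_of_nonneg_left (hinner p.1 xT) (g2nn _ _)
      _ = C * L * ∑ p ∈ PT, 1 / (1 + siteDist p.1 x₀) ^ 2 * (1 / (1 + siteDist p.1 xT) ^ 2) := by
          rw [Finset.mul_sum]; exact Finset.sum_congr rfl fun p _ => by ring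
      _ ≤ C * L * (C * L) := mul_le_mul_of_nonneg_left (htwo x₀ xT) (by positivity)
      _ = C ^ 2 * L ^ 2 := by ring
  · calc ∑ p ∈ PT, ∑ p' ∈ PT, 1 / (1 + siteDist p.1 p'.1) ^ 4 * (1 / (1 + siteDist p'.1 x₀) ^ 2) * (1 / (1 + siteDist p.1 xT) ^ 2)
        = ∑ p ∈ PT, 1 / (1 + siteDist p.1 xT) ^ 2 * ∑ p' ∈ PT, 1 / (1 + siteDist p.1 p'.1) ^ 4 * (1 / (1 + siteDist p'.1 x₀) ^ 2) := by
          refine Finset.sum_congr rfl fun p _ => ?_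
          rw [Finset.mul_sum]
          exact Finset.sum_congr rfl fun p' _ => by ring
      _ ≤ ∑ p ∈ PT, 1 / (1 + siteDist p.1 xT) ^ 2 * (C * L * (1 / (1 + siteDist p.1 x₀) ^ 2)) :=
          Finset.sum_le_sum fun p _ => mul_le_mul_of_nonneg_left (hinner p.1 x₀) (g2nn _ _)
      _ = C * L * ∑ p ∈ PT, 1 / (1 + siteDist p.1 x₀) ^ 2 * (1 / (1 + siteDist p.1 xT) ^ 2) := by
          rw [Finset.mul_sum]; exact Finset.sum_congr rfl fun p _ => by ring
      _ ≤ C * L * (C * L) := mul_le_mul_of_nonneg_left (htwo x₀ xT) (by positivity)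
      _ = C ^ 2 * L ^ 2 := by ring
  · rw [← Finset.sum_mul_sum]
    calc (∑ p ∈ PT, 1 / (1 + siteDist p.1 x₀) ^ 4) * ∑ p' ∈ PT, 1 / (1 + siteDist p'.1 xT) ^ 4
        ≤ (C * L) * (C * L) := mul_le_mul (hone x₀) (hone xT) (Finset.sum_nonneg fun p _ => g4nn _ _) (by positivity)
      _ = C ^ 2 * L ^ 2 := by ring
  · have hswap : ∑ p ∈ PT, ∑ p' ∈ PT, 1 / (1 + siteDist p'.1 x₀) ^ 4 * (1 / (1 + siteDist p.1 xT) ^ 4) =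
        (∑ p ∈ PT, 1 / (1 + siteDist p.1 xT) ^ 4) * ∑ p' ∈ PT, 1 / (1 + siteDist p'.1 x₀) ^ 4 := by
      rw [Finset.sum_mul_sum]
      exact Finset.sum_congr rfl fun p _ => Finset.sum_congr rfl fun p' _ => by ring
    rw [hswap]
    calc (∑ p ∈ PT, 1 / (1 + siteDist p.1 xT) ^ 4) * ∑ p' ∈ PT, 1 / (1 + siteDist p'.1 x₀) ^ 4
        ≤ (C * L) * (C * L) := mul_le_mul (hone xT) (hone x₀) (Finset.sum_nonneg fun p _ => g4nn _ _) (by positivity)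
      _ = C ^ 2 * L ^ 2 := by ring

end PlaqSums

end Summit.QuantumFields.YangMills.Theorems.AllWindowsColdBoxBoxHighLine

end
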